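import Literature.MathematicalPhysics.QuantumFieldTheory.ConformalBootstrap3D.PointKernelK57Data
import Literature.MathematicalPhysics.QuantumFieldTheory.ConformalBootstrap3D.PointKernelParts

/-!
# K57 certificate, kernel part file P18: one-cell head segments 156, 157 in level ranges

The head cells whose kernel evaluation exceeds one `decide` are one-cell segments of `hsegsK57`; each is
checked by `PCert.hPartSideOK` (side conditions) and `PCert.hPartOK` per level range `[n_lo, n_lo + count)`
against an integer claim, the claims summing to `≥ 0` (`PointKernel.partsOK`); soundness is
`PCert.hParts_sound` (`PointKernelParts`).  The part files `P1, P2, …` are mutually independent (each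
imports only the data file); the ranges of one cell may span several of them, and the per-cell
conclusions `hparts_i` / `hcell_i` of those cells are assembled in `PointKernelK57.lean`.
Estimated kernel time 194 s.
-/

set_option maxRecDepth 100000
set_option maxHeartbeats 0

namespace Literature.MathematicalPhysics.QuantumFieldTheory.ConformalBootstrap3D.PointKernelK57

open Literature.MathematicalPhysics.QuantumFieldTheory.ConformalBootstrap3D.PointKernel

/-- one-cell segment 156 (row 6, cell `[225/32, 901/128]`, chord, `n_F = 40`,
3 level ranges): side conditions. [folklore] -/
theorem pside_156 : certK57.hPartSideOK (PCert.segAt hsegsK57 156) JHK57 = true := by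
  decide +kernel

/-- its level ranges `(n_lo, count, claim)`. [folklore] -/
def parts_156 : List (ℕ × ℕ × ℤ) := [(0, 27, -6359590548497325148074774164828323511), (27, 12, 6579695734382982047462446226072480235), (39, 2, -220105185885656899387672061244156723)]

/-- the ranges tile `[0, n_F]` and the claims sum to `≥ 0`. [folklore] -/
theorem pcov_156 : PointKernel.partsOK 40 parts_156 = true := by
  decide +kernel

/-- levels `[0, 27)` of segment 156: partial lower sum `≥` claim. [folklore] -/
theorem part_156_0 : certK57.hPartOK (PCert.segAt hsegsK57 156) JHK57 0 27 (-6359590548497325148074774164828323511) = true := by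
  decide +kernel

/-- levels `[27, 39)` of segment 156: partial lower sum `≥` claim. [folklore] -/
theorem part_156_1 : certK57.hPartOK (PCert.segAt hsegsK57 156) JHK57 27 12 (6579695734382982047462446226072480235) = true := by
  decide +kernel

/-- levels `[39, 41)` of segment 156: partial lower sum `≥` claim. [folklore] -/
theorem part_156_2 : certK57.hPartOK (PCert.segAt hsegsK57 156) JHK57 39 2 (-220105185885656899387672061244156723) = true := by
  decide +kernel

/-- one-cell segment 157 (row 6, cell `[901/128, 451/64]`, chord, `n_F = 32`,
2 level ranges): side conditions. [folklore] -/
theorem pside_157 : certK57.hPartSideOK (PCert.segAt hsegsK57 157) JHK57 = true := by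
  decide +kernel

/-- its level ranges `(n_lo, count, claim)`. [folklore] -/
def parts_157 : List (ℕ × ℕ × ℤ) := [(0, 28, -3145816634306625268463397665549699394), (28, 5, 3145816634306625268463397665549699394)]

/-- the ranges tile `[0, n_F]` and the claims sum to `≥ 0`. [folklore] -/
theorem pcov_157 : PointKernel.partsOK 32 parts_157 = true := by
  decide +kernel

/-- levels `[0, 28)` of segment 157: partial lower sum `≥` claim. [folklore] -/
theorem part_157_0 : certK57.hPartOK (PCert.segAt hsegsK57 157) JHK57 0 28 (-3145816634306625268463397665549699394) = true := by
  decide +kernel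

end Literature.MathematicalPhysics.QuantumFieldTheory.ConformalBootstrap3D.PointKernelK57
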